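import Summits.ResolutionOfSingularities.ResolutionOfSingularities.Theorems.WeightedInvariantTerminatingCentreDatumConsumerBase
import HarnessLib

/-!
# Terminating weighted-centre data — conversions from the old data and the consumers (part 2/2: hypersurface pairs)

Companion of `WeightedInvariantTerminatingCentreDatum.lean` (route `ResolutionOfSingularities/WeightedInvariant`,
repair planner `res-wc-repair-plan-1`, TURNKEY step 5; director-resolution ruling 2026-08-27T02:14:20Z (3)).
Split note: the planner's consumer module (sha16 6b666e32f4956d86, 544 lines) is filed as TWO Theorems files for
the 400-line lint; this part = its lines 274–540 byte-identical (namespace `HypersurfaceTerminatingCentreDatum`) and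
KEEPS the planner's module name, so `import …Theorems.WeightedInvariantTerminatingCentreDatumConsumer` gives both
parts; part 1/2 is `WeightedInvariantTerminatingCentreDatumConsumerBase.lean` (`maxBot`, `TerminatingCentreDatum.ofDatum`,
the consumers on all pairs).  This module imports the route file (through the landed tower modules), so it
cannot be imported by it.  Contents:

* `HypersurfaceTerminatingCentreDatum.isRegular_iff_forall_isBot_inv` / `isBot_inv_apply_iff` /
  `genericPoint_not_mem_support_centre` — the closed-immersion readings of `(ii)` / `(iii-b′)`;
* `HypersurfaceTerminatingCentreDatum.ofHypersurfaceDatum : HypersurfaceResolutionDatum p → …` and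
  `nonempty_of_nonempty_hypersurfaceDatum`, `nonempty_of_nonempty_datum` — the re-typed hypersurface door is
  IMPLIED by the old doors;
* the CONSUMERS, sorry-free modulo Bergh–Rydh over the field at hand:
  `HypersurfaceTerminatingCentreDatum.hasResolution_quotient_of_gradedAtlas`, `hasResolution_hypersurface`,
  `hasResolution_field` (every reduced separated `k`-scheme of finite type, through the landed hypersurface
  reduction).
Nothing here asserts that such data exist.
-/

noncomputable section

open CategoryTheory CategoryTheory.Limits AlgebraicGeometry TopologicalSpace
open Literature.AlgebraicGeometry.Resolution

set_option linter.dupNamespace false -- mandated namespace of this single-conjunct summit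

namespace Summit.ResolutionOfSingularities.ResolutionOfSingularities.Theorems

namespace HypersurfaceTerminatingCentreDatum

variable {p : ℕ}

/-! ## `(ii)` and `(iii-b′)` on a closed immersion (hypersurface interface) -/

section Basic

variable (E : HypersurfaceTerminatingCentreDatum p) {k : Type} [Field k] [CharP k p] [PerfectField k]
  {Y X : Scheme.{0}} (f : Y ⟶ Spec (.of k)) [Smooth f] [IsSeparated f] [QuasiCompact f]
  (i : X ⟶ Y) [IsClosedImmersion i]

/-- `(ii)` read on a closed immersion with locally principal kernel and integral image. [folklore] -/
theorem isRegular_iff_forall_isBot_inv (hX : IsLocallyPrincipal i.ker)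
    (hXi : IsIntegral i.ker.subscheme) :
    Scheme.IsRegular X ↔ ∀ y : Y, IsBot (E.inv f i.ker y) :=
  (isRegular_iff_isRegular_image i).trans (E.forall_isBot_inv_iff f i.ker hX hXi).symm

/-- `(ii)` at a point of the hypersurface `X`. [folklore] -/
theorem isBot_inv_apply_iff (hX : IsLocallyPrincipal i.ker) (hXi : IsIntegral i.ker.subscheme)
    (x : X) : IsBot (E.inv f i.ker (i x)) ↔ IsRegularLocalRing (X.presheaf.stalk x) := by
  rw [E.isBot_inv_iff f i.ker hX hXi (i x)]
  constructor
  · intro h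
    exact (isRegularLocalRing_stalk_image_iff i x).mp
      (h (i.toImage x) ((toImage_apply_eq_iff i x _).mpr rfl))
  · intro h x' hx'
    obtain ⟨x₀, rfl⟩ := i.toImage.surjective x'
    rw [toImage_apply_eq_iff] at hx'
    have hx₀ : x₀ = x := i.isClosedEmbedding.injective hx'
    subst hx₀
    exact (isRegularLocalRing_stalk_image_iff i x₀).mpr h

/-- The generic point of the integral hypersurface `X` is off the centre. [folklore] -/
theorem genericPoint_not_mem_support_centre [IsIntegral X] (hX : IsLocallyPrincipal i.ker)
    (hXi : IsIntegral i.ker.subscheme) (hguard : ∃ y : Y, ¬ IsBot (E.inv f i.ker y)) :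
    i (genericPoint X) ∉ (E.centre f i.ker).support := by
  have hbot : IsBot (E.inv f i.ker (i (genericPoint X))) := by
    rw [E.isBot_inv_apply_iff f i hX hXi]
    change IsRegularLocalRing X.functionField
    infer_instance
  intro hmem
  exact E.support_centre_subset f i.ker hX hXi hguard hmem hbot

end Basic

/-! ## Every hypersurface resolution datum is a hypersurface terminating centre datum -/

/-- The strict transform of an integral hypersurface under the cobordant blow-up of the centre of a
hypersurface datum has integral subscheme (closed-immersion form of the ideal, then the datum-free
`isIntegral_strictTransformPlus_of_not_mem_support`). [folklore] -/
theorem isIntegral_strictTransformPlus_subscheme_of_hypersurfaceDatum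
    (D : HypersurfaceResolutionDatum p) {k : Type} [Field k] [CharP k p] [PerfectField k]
    {Y X' : Scheme.{0}} (f : Y ⟶ Spec (.of k)) [Smooth f] [IsSeparated f] [QuasiCompact f]
    (i : X' ⟶ Y) [IsClosedImmersion i] [IsIntegral X'] (X : Y.IdealSheafData) (e : i.ker = X)
    (hX : IsLocallyPrincipal X) (hXi : IsIntegral X.subscheme)
    (hguard : ∃ y : Y, ¬ IsBot (D.inv f X y)) (R' : ReesFiltration Y)
    (hR' : R'.ideal = (D.centre f X).piece)
    [Smooth (R'.πPlus ≫ f)] [IsSeparated (R'.πPlus ≫ f)] [QuasiCompact (R'.πPlus ≫ f)] :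
    IsIntegral (R'.strictTransformPlus X).subscheme := by
  subst e
  haveI : IsLocallyNoetherian Y := LocallyOfFiniteType.isLocallyNoetherian f
  have hc : (D.centre f i.ker).IsRegularWeightedCentre :=
    D.isRegularWeightedCentre_centre f i.ker hX hXi hguard
  have hξ : i (genericPoint X') ∉ (D.centre f i.ker).support :=
    HypersurfaceTower.genericPoint_not_mem_support_centre D f i hX hXi hguard
  exact (DatumToEmbedded.StrictTransform.isIntegral_strictTransformPlus_of_not_mem_support i
    (D.centre f i.ker) hc R' hR' hξ).1

/-- **Every hypersurface resolution datum is a hypersurface terminating centre datum** (so the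
hypersurface door is implied by line `datum-glued-split`'s `HypersurfaceConstruction` as well):
`rank := max inv ∈ WithBot Γ`, `(term)` by the landed `InvDrop.inv_drop_of_hypersurfaceDatum`, `(hom)`
by `CentreHomogeneous.centre_isHomogeneous_of_hypersurfaceDatum`. [folklore] -/
def ofHypersurfaceDatum (D : HypersurfaceResolutionDatum p) : HypersurfaceTerminatingCentreDatum p where
  Γ := D.Γ
  inv := D.inv
  centre := D.centre
  Λ := WithBot D.Γ
  rank := fun _ _ _ f X => maxBot (D.inv f X)
  isBot_inv_iff := fun _ _ _ _ _ f _ _ _ X hX hXi y => D.isBot_inv_iff f X hX hXi y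
  isRegularWeightedCentre_centre := fun _ _ _ _ _ f _ _ _ X hX hXi h =>
    D.isRegularWeightedCentre_centre f X hX hXi h
  support_centre_subset := fun _ _ _ _ _ f _ _ _ X hX hXi h y hy => by
    rw [D.support_centre f X hX hXi h] at hy
    have hy' : ∀ y', D.inv f X y' ≤ D.inv f X y := by simpa only [Set.mem_setOf_eq] using hy
    obtain ⟨y₁, hy₁⟩ := h
    exact fun hb => hy₁ fun γ => (hy' y₁).trans (hb γ)
  centre_isHomogeneous := fun _ _ _ _ _ f _ _ _ X hX hXi h j W 𝒜 _ h0 hXh n =>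
    DatumToEmbedded.CentreHomogeneous.centre_isHomogeneous_of_hypersurfaceDatum D f X hX hXi h W 𝒜
      h0 hXh n
  rank_lt := fun _ _ _ _ _ f _ _ _ X hX hXi h R' hR' => by
    obtain ⟨y₁, hy₁⟩ := h
    haveI : Nonempty _ := ⟨y₁⟩
    haveI : IsLocallyNoetherian _ := LocallyOfFiniteType.isLocallyNoetherian f
    have hY : Scheme.IsRegular _ := Scheme.IsRegular.of_smooth f (Scheme.isRegular_Spec (.of _))
    haveI : IsIntegral X.subscheme := hXi
    obtain ⟨y₀, hy₀, hmax⟩ :=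
      exists_maxBot_eq (D.inv f X) (HypersurfaceTower.exists_isMax_inv D f X hX hXi)
    have hc : (D.centre f X).IsRegularWeightedCentre :=
      D.isRegularWeightedCentre_centre f X hX hXi ⟨y₁, hy₁⟩
    obtain ⟨hsm, hsep, hqc⟩ :=
      WeightedThesis.GlobalCobordantPlus.smooth_πPlus_comp_of_isRegularWeightedCentre f (D.centre f X)
        hc R' hR'
    haveI := hsm; haveI := hsep; haveI := hqc
    have hI' : IsLocallyPrincipal (R'.strictTransformPlus X) :=
      WeightedThesis.HypersurfacePreserved.isLocallyPrincipal_strictTransformPlus hY (D.centre f X) hc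
        R' hR' X hX
    have hI'i : IsIntegral (R'.strictTransformPlus X).subscheme :=
      isIntegral_strictTransformPlus_subscheme_of_hypersurfaceDatum D f X.subschemeι X
        (Scheme.IdealSheafData.ker_subschemeι X) hX hXi ⟨y₁, hy₁⟩ R' hR'
    have hdrop := DatumToEmbedded.InvDrop.inv_drop_of_hypersurfaceDatum D f X hX hXi ⟨y₁, hy₁⟩ y₀
      hy₀ R' hR' hI' hI'i
    show maxBot (D.inv (R'.πPlus ≫ f) (R'.strictTransformPlus X)) < maxBot (D.inv f X)
    rw [hmax]
    exact maxBot_lt_coe _ hdrop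

/-- Hence `HypersurfaceConstruction ⇒` the hypersurface door, prime by prime. [folklore] -/
theorem nonempty_of_nonempty_hypersurfaceDatum (h : Nonempty (HypersurfaceResolutionDatum p)) :
    Nonempty (HypersurfaceTerminatingCentreDatum p) :=
  h.map ofHypersurfaceDatum

/-- … and the old door `Nonempty (WeightedResolutionDatum p)` implies it too. [folklore] -/
theorem nonempty_of_nonempty_datum (h : Nonempty (WeightedResolutionDatum p)) :
    Nonempty (HypersurfaceTerminatingCentreDatum p) :=
  nonempty_of_nonempty (TerminatingCentreDatum.nonempty_of_nonempty h)

/-! ## The consumer on hypersurface pairs -/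

/-- **Every torus-quotient presentation of an integral hypersurface of `Y/k` has a resolved quotient,
granted a hypersurface terminating centre datum at `p = char k` and Bergh–Rydh over `k`** — the tower of
`HypersurfaceTower.hasResolution_quotient_of_gradedAtlas` with `max inv` replaced by the rank of pairs;
the successor of a hypersurface pair is a hypersurface pair (`isLocallyPrincipal_strictTransformPlus`,
`isIntegral_strictTransformPlus_of_not_mem_support`). [cite: Wlodarczyk2022, Thm 1.1.4 (5), Thm 1.1.6; BerghRydh2019, Thm 5] -/
theorem hasResolution_quotient_of_gradedAtlas
    (E : HypersurfaceTerminatingCentreDatum p) {k : Type} [Field k] [CharP k p] [PerfectField k]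
    (hBR : ∀ (V : Scheme.{0}) (g : V ⟶ Spec (.of k)) [IsIntegral V] [IsSeparated g]
      [LocallyOfFiniteType g] [QuasiCompact g],
      (∀ v : V, ∃ (A : Type) (_ : AddCommGroup A) (_ : Finite A) (_ : DecidableEq A)
        (S : Type) (_ : CommRing S) (_ : Algebra k S) (𝒮 : A → Submodule k S)
        (_ : GradedAlgebra 𝒮), Algebra.FiniteType k S ∧ Algebra.Smooth k S ∧
        ∃ φ : Spec (.of (𝒮 0)) ⟶ V, Etale φ ∧ v ∈ Set.range φ ∧
          φ ≫ g = Spec.map (CommRingCat.ofHom (algebraMap k (𝒮 0)))) →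
      Scheme.HasResolution V)
    (Y : Scheme.{0}) (f : Y ⟶ Spec (.of k)) [Smooth f] [IsSeparated f] [QuasiCompact f]
    (I : Y.IdealSheafData) (hI : IsLocallyPrincipal I) (hIi : IsIntegral I.subscheme) :
    ∀ (X V : Scheme.{0}) (i : X ⟶ Y) [IsClosedImmersion i] [IsIntegral X], i.ker = I →
      ∀ (g : V ⟶ Spec (.of k)) [IsSeparated g] [LocallyOfFiniteType g] [QuasiCompact g]
        [IsIntegral V] (q : X ⟶ V), q ≫ g = i ≫ f → ∀ (j : ℕ), GradedAtlas j f i q →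
        Scheme.HasResolution V := by
  have key := E.rank_induction
    (fun (Y : Scheme.{0}) (f : Y ⟶ Spec (.of k)) (I : Y.IdealSheafData) =>
      ∀ [Smooth f] [IsSeparated f] [QuasiCompact f] (X V : Scheme.{0}) (i : X ⟶ Y)
        [IsClosedImmersion i] [IsIntegral X], i.ker = I →
        ∀ (g : V ⟶ Spec (.of k)) [IsSeparated g] [LocallyOfFiniteType g] [QuasiCompact g]
          [IsIntegral V] (q : X ⟶ V), q ≫ g = i ≫ f → ∀ (j : ℕ), GradedAtlas j f i q →
          Scheme.HasResolution V) ?base ?step Y f I hI hIi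
  · exact fun X V i _ _ hIeq g _ _ _ _ q hq j 𝒜 => key X V i hIeq g q hq j 𝒜
  · -- base: `inv` everywhere minimal ⇒ `X` regular ⇒ quotient singularities ⇒ Bergh–Rydh over `k`
    intro Y f _ _ _ I hI hIi hbot _ _ _ X V i _ _ hIeq g _ _ _ _ q hq j 𝒜
    subst hIeq
    have hreg : Scheme.IsRegular X := (E.isRegular_iff_forall_isBot_inv f i hI hIi).mpr hbot
    exact hBR V g (DatumToEmbedded.quotientSingularities_of_regular f i q g hq hreg 𝒜)
  · -- step
    intro Y f _ _ _ I hI hIi hguard ih _ _ _ X V i _ _ hIeq g _ _ _ _ q hq j 𝒜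
    subst hIeq
    haveI : IsLocallyNoetherian Y := LocallyOfFiniteType.isLocallyNoetherian f
    have hY : Scheme.IsRegular Y := Scheme.IsRegular.of_smooth f (Scheme.isRegular_Spec (.of k))
    -- the centre is a regular weighted centre missing the generic point of `X`
    have hc : (E.centre f i.ker).IsRegularWeightedCentre :=
      E.isRegularWeightedCentre_centre f i.ker hI hIi hguard
    have hξ : i (genericPoint X) ∉ (E.centre f i.ker).support :=
      E.genericPoint_not_mem_support_centre f i hI hIi hguard
    -- the Rees filtration of the centre
    let R' : ReesFiltration Y :=
      { ideal := (E.centre f i.ker).piece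
        ideal_zero := (E.centre f i.ker).piece_zero
        antitone := antitone_piece hc
        mul_le := (E.centre f i.ker).piece_mul_le }
    -- the new ambient is smooth separated quasi-compact
    obtain ⟨hsm', hsep', hqc'⟩ :=
      WeightedThesis.GlobalCobordantPlus.smooth_πPlus_comp_of_isRegularWeightedCentre f
        (E.centre f i.ker) hc R' rfl
    haveI := hsm'; haveI := hsep'; haveI := hqc'
    -- the strict transform is integral and lies over `X`
    obtain ⟨hint', hker⟩ :=
      DatumToEmbedded.StrictTransform.isIntegral_strictTransformPlus_of_not_mem_support i
        (E.centre f i.ker) hc R' rfl hξ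
    haveI := hint'
    set I' := R'.strictTransformPlus i.ker with hI'
    -- the successor pair is a hypersurface pair
    have hI'lp : IsLocallyPrincipal I' :=
      WeightedThesis.HypersurfacePreserved.isLocallyPrincipal_strictTransformPlus hY
        (E.centre f i.ker) hc R' rfl i.ker hI
    have hI'i : IsIntegral I'.subscheme := hint'
    let i' := I'.subschemeι
    let σX : I'.subscheme ⟶ X := IsClosedImmersion.lift i (i' ≫ R'.πPlus) hker
    have hσX : σX ≫ i = i' ≫ R'.πPlus := IsClosedImmersion.lift_fac _ _ _
    -- homogeneity of the centre on the charts (axiom `(hom)`), then the quotient step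
    have hhom := fun (a : 𝒜.ι) (n : ℕ) =>
      @HypersurfaceTerminatingCentreDatum.centre_isHomogeneous p E k _ _ _ Y f _ _ _ i.ker hI hIi
        hguard j (𝒜.W a) (𝒜.piece a) (𝒜.gradedRing a) (𝒜.appLE_mem a) (𝒜.isHomogeneous_ker a) n
    obtain ⟨K, hK, hstep⟩ := DatumToEmbedded.quotientStep_of_isRegularWeightedCentre f i q g hq 𝒜
      (E.centre f i.ker) hc hξ hhom R' rfl σX hσX
    -- blow `V` up along `K`
    obtain ⟨V', ρ, hρ⟩ := exists_isBlowup V K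
    haveI : IsLocallyNoetherian V := LocallyOfFiniteType.isLocallyNoetherian g
    haveI : IsProper ρ := hρ.isProper
    have hbir : IsBirational ρ := hρ.isBirational' hK
    haveI : IsIntegral V' := hρ.isIntegral hK
    obtain ⟨q', hq', ⟨𝒜'⟩⟩ := hstep V' ρ hρ
    -- the rank drops (axiom `(term)`), and the induction hypothesis resolves `V'`
    have hdrop : E.rank (R'.πPlus ≫ f) I' < E.rank f i.ker := E.rank_lt f i.ker hI hIi hguard R' rfl
    have hV' : Scheme.HasResolution V' := by
      have hQ' := ih (R'.plus : Scheme.{0}) (R'.πPlus ≫ f) I' hI'lp hI'i hdrop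
      refine hQ' I'.subscheme V' i' (Scheme.IdealSheafData.ker_subschemeι I') (ρ ≫ g) q' ?_
        (j + 1) 𝒜'
      rw [← Category.assoc, hq', Category.assoc, hq, ← Category.assoc, hσX, Category.assoc]
    exact Scheme.HasResolution.of_isBirational ρ hbir hV'

/-- **A hypersurface terminating centre datum in characteristic `p` and Bergh–Rydh over the perfect
field `k` of characteristic `p` resolve every integral HYPERSURFACE of every smooth separated
quasi-compact `k`-scheme** (the tower on the trivial presentation). [cite: Wlodarczyk2022, Thm 1.1.6; BerghRydh2019, Thm 5] -/
theorem hasResolution_hypersurface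
    (E : HypersurfaceTerminatingCentreDatum p) {k : Type} [Field k] [CharP k p] [PerfectField k]
    (hBR : ∀ (V : Scheme.{0}) (g : V ⟶ Spec (.of k)) [IsIntegral V] [IsSeparated g]
      [LocallyOfFiniteType g] [QuasiCompact g],
      (∀ v : V, ∃ (A : Type) (_ : AddCommGroup A) (_ : Finite A) (_ : DecidableEq A)
        (S : Type) (_ : CommRing S) (_ : Algebra k S) (𝒮 : A → Submodule k S)
        (_ : GradedAlgebra 𝒮), Algebra.FiniteType k S ∧ Algebra.Smooth k S ∧
        ∃ φ : Spec (.of (𝒮 0)) ⟶ V, Etale φ ∧ v ∈ Set.range φ ∧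
          φ ≫ g = Spec.map (CommRingCat.ofHom (algebraMap k (𝒮 0)))) →
      Scheme.HasResolution V)
    {Y X : Scheme.{0}} (f : Y ⟶ Spec (.of k)) [Smooth f] [IsSeparated f] [QuasiCompact f]
    (i : X ⟶ Y) [IsClosedImmersion i] [IsIntegral X] (hX : IsLocallyPrincipal i.ker) :
    Scheme.HasResolution X := by
  obtain ⟨𝒜₀⟩ := DatumToEmbedded.InitialAtlas.stub_initialAtlas f i
  haveI : IsSeparated (i ≫ f) := inferInstance
  haveI : LocallyOfFiniteType (i ≫ f) := inferInstance
  haveI : QuasiCompact (i ≫ f) := inferInstance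
  exact hasResolution_quotient_of_gradedAtlas E hBR Y f i.ker hX
    (HypersurfaceTower.isIntegral_ker_subscheme i) X X i rfl (i ≫ f) (𝟙 X) (Category.id_comp _) 0 𝒜₀

/-- **A hypersurface terminating centre datum in characteristic `p` and Bergh–Rydh over the perfect
field `k` of characteristic `p` resolve every reduced separated `k`-scheme of finite type**
(`hasResolution_hypersurface` spread by the landed hypersurface reduction
`WeightedThesis.HypersurfacesIff.hasResolution_of_hypersurfaces`: irreducible components, Chow's lemma,
hypersurface models, finite birational transfer).
[cite: Wlodarczyk2022, Thm 1.1.6; BerghRydh2019, Thm 5; Kollar2007, Prop. 2.48 (proof)] -/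
theorem hasResolution_field
    (hp : p.Prime) (E : HypersurfaceTerminatingCentreDatum p) {k : Type} [Field k] [CharP k p]
    [PerfectField k]
    (hBR : ∀ (V : Scheme.{0}) (g : V ⟶ Spec (.of k)) [IsIntegral V] [IsSeparated g]
      [LocallyOfFiniteType g] [QuasiCompact g],
      (∀ v : V, ∃ (A : Type) (_ : AddCommGroup A) (_ : Finite A) (_ : DecidableEq A)
        (S : Type) (_ : CommRing S) (_ : Algebra k S) (𝒮 : A → Submodule k S)
        (_ : GradedAlgebra 𝒮), Algebra.FiniteType k S ∧ Algebra.Smooth k S ∧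
        ∃ φ : Spec (.of (𝒮 0)) ⟶ V, Etale φ ∧ v ∈ Set.range φ ∧
          φ ≫ g = Spec.map (CommRingCat.ofHom (algebraMap k (𝒮 0)))) →
      Scheme.HasResolution V)
    (X : Scheme.{0}) (f : X ⟶ Spec (.of k)) [IsSeparated f] [LocallyOfFiniteType f]
    [QuasiCompact f] [IsReduced X] : Scheme.HasResolution X :=
  WeightedThesis.HypersurfacesIff.hasResolution_of_hypersurfaces hp k
    (fun Y H g j hg hs hq hj hint hpr => by
      haveI := hg; haveI := hs; haveI := hq; haveI := hj; haveI := hint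
      exact hasResolution_hypersurface E hBR g j (isLocallyPrincipal_of_forall_isPrincipal hpr)) X f

end HypersurfaceTerminatingCentreDatum

end Summit.ResolutionOfSingularities.ResolutionOfSingularities.Theorems

end
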